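import Summits.BirchSwinnertonDyer.Rank1Residual.Additive.X4TamDefectLevelLoweringFromWilesIharaKim2025
import Summits.BirchSwinnertonDyer.Rank1Residual.X4.LevelLoweredEigenDatum
import HarnessLib

/-!
# TAM-DEFECT₂ on the twist-good locus over ONE typed datum: the ENDs keyed to `HasLevelLoweredEigenDatum` (cell `b2b-bsdres`, seat additive-p4, line V44)

HONEST FRAMING (verbatim, cell `b2b-bsdres`): the goal of the cell is to DELETE the COMBINATION-SHAPED
residual classes for ALL analytic-rank `≤ 1` curves over `ℚ` — "full BSD formula for every rank `≤ 1`
curve in class `C`" assembled STRICTLY from published theorems — so that the rank-`≤ 1` remainder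
becomes exactly the CONSTRUCTION-SHAPED classes, which are TYPED (missing-input Props), NOT attempted;
this is not "finishing BSD". This file: TOOL theorems, 0 defs, 0 facts, nothing booked; X4
CONSTRUCTION-SHAPED. The four census-shape ENDs of line V44 (`p ≥ 5` published / `p ≥ 3` modulo the
ANNOUNCED Kim 2025 clause; even / odd twists) with the dozen level-`M` binders of
`X4.bsdp_of_wiles1995_ihara_quadraticTwist_of_{pos,neg}_of_{five_le,kim2025_OPEN}` REPLACED by the ONE
typed predicate `LevelLowering.HasLevelLoweredEigenDatum k M ℓ θ̄_{W₀} μ` (gen 25 K50).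

## NET SHAPE of the V42/V44 class theorem (TAM-DEFECT₂, twist-good locus) after this file

`BSD(E,p)` for `E = C • W₀^{(d)}` on a unit TAM-DEFECT₂ row ⟸
* PUBLISHED named facts BY NAME: Kim 2026 Thm. 1.8 (6) [`p ≥ 5`] (resp. the ANNOUNCED Kim 2025 clause,
  OPEN binder, `p ≥ 3`), Cassels–Tate, GZK, modularity, `wiles1995_multiplicityOne` (DDT Thm. 4.26),
  `ribet1984_iharaLemma` (Ribet 1984 Thm. 4.1);
* TWO typed targets (assert nothing): the Eichler–Shimura dictionary node
  `EichlerShimuraModPMultiplicityOne{,Minus}OfIrreducible` and the level-`M` eigen datum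
  `HasLevelLoweredEigenDatum` of Ribet's level-lowered form (existence = Ribet 1990 Thm. 1.1 +
  `U`-stabilisation + its mod-`𝔭` symbol — the lane's node (T2′));
* per-row numerals (r_an, image, conductor-level datum / period transfer, `#Ш_an` unit, `ord_p ∏c ≤ 2`,
  the twist datum, the eigencharacter `χ₀` with DDT's hypotheses and Galois package, the Tamagawa
  prime `ℓ`, parity of `μ`, the two signs `w θ̄(ℓ) = 1`, `w χ_d(ℓ) = 1`, and at `p = 3` the rider).

## References

* K. A. Ribet, Invent. Math. 100 (1990), Thm. 1.1; Proc. ICM 1983 (1984), Thm. 4.1. [cite: Ribet1990, Thm. 1.1 and Thm. 5.2 (b)] [cite: Ribet1984ICM, Thm. 4.1]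
* H. Darmon, F. Diamond, R. Taylor, *Fermat's Last Theorem* (1995), Thm. 4.26. [cite: DarmonDiamondTaylor1995, Thm. 4.26 (§4.5, p. 134) and Lemma 4.28 (a) (p. 135)]
* C.-H. Kim, Amer. J. Math. 148 (2026), Thm. 1.9 (6); arXiv:2505.09121 (2025), Thm. 1.1 (ANNOUNCED). [cite: Kim2022StructureSelmer, Thm. 1.9 (6) and Conj. 1.10 (PDF p. 8)] [cite: Kim2025RefinedTNC, Thm. 1.1 ("BSD") (ANNOUNCED, OPEN binder)]
* J. H. Silverman, *The Arithmetic of Elliptic Curves* (2009), Thm. X.4.14. [cite: SilvermanAEC2009, Thm. X.4.14]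
-/

noncomputable section

open scoped MatrixGroups ModularForm NumberTheorySymbols NumberField

open CongruenceSubgroup Finset IsDedekindDomain Polynomial

open Literature.NumberTheory.EllipticCurves Literature.NumberTheory.EllipticCurves.ModularForms
  Literature.NumberTheory.EllipticCurves.ModularForms.HidaCohomology

namespace Summit.BirchSwinnertonDyer.Rank1Residual.X4

open Complex WeierstrassCurve Literature.NumberTheory.EllipticCurves.Rank1Residual
  Literature.NumberTheory.EllipticCurves.Rank1Residual.Typed
  Summit.BirchSwinnertonDyer.Rank1Residual.Additive
  Summit.BirchSwinnertonDyer.Rank1Residual.LevelLowering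
  Literature.NumberTheory.GaloisRepresentations Rat.HeightOneSpectrum

variable {k : Type*} [CommRing k] [Nontrivial k]
  (W₀ W : WeierstrassCurve ℚ) [W₀.IsElliptic] [W₀.IsGloballyMinimal] [W.IsElliptic] [W.IsGloballyMinimal]
  (p : ℕ) [hp5 : Fact p.Prime] (ι : ZMod p →+* k)

/-- **TAM-DEFECT₂, twist-good locus, even twists `d > 0`, `p ≥ 5` (PUBLISHED inputs) — over the ONE
typed datum.** `BSD(E,p)` from Kim 2026 Thm. 1.8 (6), Cassels–Tate, GZK, modularity,
`wiles1995_multiplicityOne`, `ribet1984_iharaLemma` (all BY NAME) + the dictionary target + the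
level-`M` eigen datum `HasLevelLoweredEigenDatum k M ℓ θ̄_{W₀} μ` (even `μ`) + numerals. Nothing booked.
[cite: Kim2022StructureSelmer, Thm. 1.9 (6) and Conj. 1.10 (PDF p. 8)]
[cite: DarmonDiamondTaylor1995, Thm. 4.26 (§4.5, p. 134) and Lemma 4.28 (a) (p. 135)]
[cite: Ribet1984ICM, Thm. 4.1] [cite: Ribet1990, Thm. 1.1 and Thm. 5.2 (b)] [cite: SilvermanAEC2009, Thm. X.4.14] -/
theorem bsdp_of_levelLoweredEigenDatum_quadraticTwist_of_pos_of_five_le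
    (hW1 : wiles1995_multiplicityOne) (hI : ribet1984_iharaLemma)
    (hKimk : Kim2026.rankZero_le_padicValNat_sha_of_kuriharaNumber_ne_zero)
    (hE67c : Kim2026.rankZero_padicValNat_sha_add_le_of_forall_pow_dvd_kuriharaNumber_cyclicLevel)
    (hCT : exists_casselsTate_pairing (K := ℚ))
    (hGZK : rank_eq_analyticRank_of_analyticRank_le_one) (hmod : hasEntireLFunction_rat)
    (hp : 5 ≤ p) (hr : W.analyticRank = 0) (hsurj : W.HasSurjectiveModNGaloisRep p)
    {N : ℕ} [NeZero N] (D : ModularParametrizationData W N) (hN : W.conductorNorm ℤ = N)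
    (hc : ¬ (p : ℤ) ∣ D.maninConstant)
    (hper : ∃ u : ℚ, ‖(u : ℚ_[p])‖ = 1 ∧ W.realPeriodRat = u * plusPeriod D.f)
    {q' : ℚ} (hq' : shaAn W = (q' : ℂ)) (hv : padicValRat p q' = 0)
    (hc2 : padicValNat p W.tamagawaProduct ≤ 2)
    -- the geometric twist datum
    {d : ℤ} (hd4 : d % 4 = 1) (hsq : Squarefree d) (hd : 0 < d) (C : VariableChange ℚ)
    (hC : C • W₀.quadraticTwist (d : ℚ) = W)
    (hgm : ∀ v : HeightOneSpectrum (𝓞 ℚ), ((Rat.HeightOneSpectrum.primesEquiv v : ℕ) : ℤ) ∣ d →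
      W₀.HasGoodReductionAt v ∨ W₀.HasMultiplicativeReductionAt v)
    -- the twist partner's newform at level `M ℓ`, `ℓ` the Tamagawa prime, `ℓ ∤ M`
    {M : ℕ} [NeZero M] {ℓ : ℕ} [Fact ℓ.Prime] [NeZero (M * ℓ)] (hℓM : ¬ ℓ ∣ M) [NeZero d.natAbs]
    {f₀ : CuspForm (Gamma0 (M * ℓ)) 2} (hf₀ : IsNewformOf W₀ f₀)
    (hN₀ : M * ℓ ∣ N) (hm : d.natAbs ^ 2 ∣ N) (hmN : d.natAbs ∣ W.conductorNorm ℤ)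
    (hper₀ : ∃ u : ℚ, ‖(u : ℚ_[p])‖ = 1 ∧ W₀.realPeriodRat = u * plusPeriod f₀)
    (hirr₀ : W₀.HasIrreducibleModPGaloisRep p)
    (hℓN : ℓ ∣ W.conductorNorm ℤ) (hℓ : ℓ.Coprime d.natAbs)
    -- (MO) from print: eigencharacter, DDT Thm. 4.26 hypotheses + Galois package, repaired dictionary
    (χ₀ : HeckeRing0 (M * ℓ) 2 →+* k)
    (hχ₀ : ∀ (q : ℕ) (hq : q.Prime),
      χ₀ (HeckeRing0.T (M * ℓ) 2 q hq) = ι ((W₀.LFunction q : ℤ) : ZMod p))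
    (hp𝔪 : (p : HeckeRing0 (M * ℓ) 2) ∈ RingHom.ker χ₀) (h𝔪 : (RingHom.ker χ₀).IsMaximal)
    (hpN₀ : ¬ p ∣ M * ℓ ∨ (¬ p ^ 2 ∣ M * ℓ ∧ HeckeRing0.T (M * ℓ) 2 p hp5.out ∉ RingHom.ker χ₀))
    (k' : Type) [Field k'] [TopologicalSpace k'] [DiscreteTopology k']
    (ι' : HeckeRing0 (M * ℓ) 2 ⧸ RingHom.ker χ₀ →+* k') (ρ : ModPGaloisRep ℚ k' 2)
    (hρ : ∀ v : HeightOneSpectrum (𝓞 ℚ), ¬ ((primesEquiv v : Nat.Primes) : ℕ) ∣ M * ℓ * p →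
        ρ.IsUnramifiedAt v ∧
          ρ.HasFrobCharpolyAt v
            (X ^ 2
              - Polynomial.C (ι' (Ideal.Quotient.mk (RingHom.ker χ₀) (HeckeRing0.T (M * ℓ) 2
                  ((primesEquiv v : Nat.Primes) : ℕ) (primesEquiv v : Nat.Primes).2))) * X
              + Polynomial.C (((primesEquiv v : Nat.Primes) : ℕ) : k')))
    (hρirr : FramedRep.IsIrreducible ρ)
    (hES : EichlerShimuraModPMultiplicityOneOfIrreducible (M * ℓ) p χ₀
      (fun q ↦ ι ((W₀.LFunction q : ℤ) : ZMod p)))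
    -- (OLD) from print: the LEVEL-`M` EIGEN DATUM of Ribet's form (ONE predicate) + numerals
    {μ : ℚ → k}
    (hdat : HasLevelLoweredEigenDatum k M ℓ (fun q ↦ ι ((W₀.LFunction q : ℤ) : ZMod p)) μ)
    (heven : ∀ r : ℚ, μ (-r) = μ r) {w : k}
    (hwα : w * ι ((W₀.LFunction ℓ : ℤ) : ZMod p) = 1)
    (hw : w * ι ((J((ℓ : ℤ) | d.natAbs) : ℤ) : ZMod p) = 1) : BSDp W p := by
  obtain ⟨hμ, hΓ, ⟨θ, hT, hU, hθ, hα⟩, ⟨Λ, χ, hΛ, h𝔫, hE, ⟨x, hx, hΛx⟩, hμΛ⟩⟩ := hdat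
  exact bsdp_of_wiles1995_ihara_quadraticTwist_of_pos_of_five_le W₀ W p ι hW1 hI hKimk hE67c hCT
    hGZK hmod hp hr hsurj D hN hc hper hq' hv hc2 hd4 hsq hd C hC hgm hℓM hf₀ hN₀ hm hmN hper₀ hirr₀
    hℓN hℓ χ₀ hχ₀ hp𝔪 h𝔪 hpN₀ k' ι' ρ hρ hρirr hES hμ heven hΓ θ hT hU hθ hα hwα Λ χ hΛ h𝔫 hE hx hΛx
    hμΛ hw

/-- **TAM-DEFECT₂, twist-good locus, odd twists `d < 0`, `p ≥ 5` (PUBLISHED inputs) — over the ONE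
typed datum** (odd `μ`, minus dictionary target, imaginary period transfer, minus-symbol integrality
numeral). Nothing booked. [cite: Kim2022StructureSelmer, Thm. 1.9 (6) and Conj. 1.10 (PDF p. 8)]
[cite: DarmonDiamondTaylor1995, Thm. 4.26 (§4.5, p. 134) and Lemma 4.28 (a) (p. 135)]
[cite: Ribet1984ICM, Thm. 4.1] [cite: Ribet1990, Thm. 1.1 and Thm. 5.2 (b)] [cite: SilvermanAEC2009, Thm. X.4.14] -/
theorem bsdp_of_levelLoweredEigenDatum_quadraticTwist_of_neg_of_five_le
    (hW1 : wiles1995_multiplicityOne) (hI : ribet1984_iharaLemma)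
    (hKimk : Kim2026.rankZero_le_padicValNat_sha_of_kuriharaNumber_ne_zero)
    (hE67c : Kim2026.rankZero_padicValNat_sha_add_le_of_forall_pow_dvd_kuriharaNumber_cyclicLevel)
    (hCT : exists_casselsTate_pairing (K := ℚ))
    (hGZK : rank_eq_analyticRank_of_analyticRank_le_one) (hmod : hasEntireLFunction_rat)
    (hp : 5 ≤ p) (hr : W.analyticRank = 0) (hsurj : W.HasSurjectiveModNGaloisRep p)
    {N : ℕ} [NeZero N] (D : ModularParametrizationData W N) (hN : W.conductorNorm ℤ = N)
    (hc : ¬ (p : ℤ) ∣ D.maninConstant)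
    (hper : ∃ u : ℚ, ‖(u : ℚ_[p])‖ = 1 ∧ W.realPeriodRat = u * plusPeriod D.f)
    {q' : ℚ} (hq' : shaAn W = (q' : ℂ)) (hv : padicValRat p q' = 0)
    (hc2 : padicValNat p W.tamagawaProduct ≤ 2)
    {d : ℤ} (hd4 : d % 4 = 1) (hsq : Squarefree d) (hd : d < 0) (C : VariableChange ℚ)
    (hC : C • W₀.quadraticTwist (d : ℚ) = W)
    (hgm : ∀ v : HeightOneSpectrum (𝓞 ℚ), ((Rat.HeightOneSpectrum.primesEquiv v : ℕ) : ℤ) ∣ d →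
      W₀.HasGoodReductionAt v ∨ W₀.HasMultiplicativeReductionAt v)
    {M : ℕ} [NeZero M] {ℓ : ℕ} [Fact ℓ.Prime] [NeZero (M * ℓ)] (hℓM : ¬ ℓ ∣ M) [NeZero d.natAbs]
    {f₀ : CuspForm (Gamma0 (M * ℓ)) 2} (hf₀ : IsNewformOf W₀ f₀)
    (hN₀ : M * ℓ ∣ N) (hm : d.natAbs ^ 2 ∣ N) (hmN : d.natAbs ∣ W.conductorNorm ℤ)
    (hper₀ : ∃ u : ℚ, ‖(u : ℚ_[p])‖ = 1 ∧ W₀.imaginaryPeriodRat = u * minusPeriod f₀)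
    (hint : ∀ x : ℚ, ¬ p ∣ (ratMinusSymbol f₀ x).den)
    (hℓN : ℓ ∣ W.conductorNorm ℤ) (hℓ : ℓ.Coprime d.natAbs)
    -- (MO⁻) from print
    (χ₀ : HeckeRing0 (M * ℓ) 2 →+* k)
    (hχ₀ : ∀ (q : ℕ) (hq : q.Prime),
      χ₀ (HeckeRing0.T (M * ℓ) 2 q hq) = ι ((W₀.LFunction q : ℤ) : ZMod p))
    (hp𝔪 : (p : HeckeRing0 (M * ℓ) 2) ∈ RingHom.ker χ₀) (h𝔪 : (RingHom.ker χ₀).IsMaximal)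
    (hpN₀ : ¬ p ∣ M * ℓ ∨ (¬ p ^ 2 ∣ M * ℓ ∧ HeckeRing0.T (M * ℓ) 2 p hp5.out ∉ RingHom.ker χ₀))
    (k' : Type) [Field k'] [TopologicalSpace k'] [DiscreteTopology k']
    (ι' : HeckeRing0 (M * ℓ) 2 ⧸ RingHom.ker χ₀ →+* k') (ρ : ModPGaloisRep ℚ k' 2)
    (hρ : ∀ v : HeightOneSpectrum (𝓞 ℚ), ¬ ((primesEquiv v : Nat.Primes) : ℕ) ∣ M * ℓ * p →
        ρ.IsUnramifiedAt v ∧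
          ρ.HasFrobCharpolyAt v
            (X ^ 2
              - Polynomial.C (ι' (Ideal.Quotient.mk (RingHom.ker χ₀) (HeckeRing0.T (M * ℓ) 2
                  ((primesEquiv v : Nat.Primes) : ℕ) (primesEquiv v : Nat.Primes).2))) * X
              + Polynomial.C (((primesEquiv v : Nat.Primes) : ℕ) : k')))
    (hρirr : FramedRep.IsIrreducible ρ)
    (hES : EichlerShimuraModPMultiplicityOneMinusOfIrreducible (M * ℓ) p χ₀
      (fun q ↦ ι ((W₀.LFunction q : ℤ) : ZMod p)))
    -- (OLD) from print: the LEVEL-`M` EIGEN DATUM of Ribet's form (ONE predicate) + numerals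
    {μ : ℚ → k}
    (hdat : HasLevelLoweredEigenDatum k M ℓ (fun q ↦ ι ((W₀.LFunction q : ℤ) : ZMod p)) μ)
    (hodd : ∀ r : ℚ, μ (-r) = -μ r) {w : k}
    (hwα : w * ι ((W₀.LFunction ℓ : ℤ) : ZMod p) = 1)
    (hw : w * ι ((J((ℓ : ℤ) | d.natAbs) : ℤ) : ZMod p) = 1) : BSDp W p := by
  obtain ⟨hμ, hΓ, ⟨θ, hT, hU, hθ, hα⟩, ⟨Λ, χ, hΛ, h𝔫, hE, ⟨x, hx, hΛx⟩, hμΛ⟩⟩ := hdat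
  exact bsdp_of_wiles1995_ihara_quadraticTwist_of_neg_of_five_le W₀ W p ι hW1 hI hKimk hE67c hCT
    hGZK hmod hp hr hsurj D hN hc hper hq' hv hc2 hd4 hsq hd C hC hgm hℓM hf₀ hN₀ hm hmN hper₀ hint
    hℓN hℓ χ₀ hχ₀ hp𝔪 h𝔪 hpN₀ k' ι' ρ hρ hρirr hES hμ hodd hΓ θ hT hU hθ hα hwα Λ χ hΛ h𝔫 hE hx hΛx
    hμΛ hw

/-- **TAM-DEFECT₂, twist-good locus, even twists `d > 0`, `p ≥ 3` TOWER rows modulo the ANNOUNCED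
Kim 2025 clause (OPEN binder) — over the ONE typed datum;** at `p = 3` (N11) the rider is displayed.
Nothing booked. [claim: Kim2025RefinedTNC, status: under-review]
[cite: Kim2025RefinedTNC, Thm. 1.1 ("BSD") (ANNOUNCED, OPEN binder)]
[cite: DarmonDiamondTaylor1995, Thm. 4.26 (§4.5, p. 134) and Lemma 4.28 (a) (p. 135)]
[cite: Ribet1984ICM, Thm. 4.1] [cite: Ribet1990, Thm. 1.1 and Thm. 5.2 (b)] [cite: SilvermanAEC2009, Thm. X.4.14] -/
theorem bsdp_of_levelLoweredEigenDatum_quadraticTwist_of_pos_of_kim2025_OPEN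
    (hW1 : wiles1995_multiplicityOne) (hI : ribet1984_iharaLemma)
    (hK25s : Kim2025.thm11_kimShaLength_of_integralPeriod_OPEN)
    (hCT : exists_casselsTate_pairing (K := ℚ))
    (hGZK : rank_eq_analyticRank_of_analyticRank_le_one) (hmod : hasEntireLFunction_rat)
    (hp3 : 3 ≤ p) (hr : W.analyticRank = 0)
    (htower : ∀ n : ℕ, W.HasSurjectiveModNGaloisRep (p ^ n : ℕ))
    {N : ℕ} [NeZero N] (D : ModularParametrizationData W N) (hN : W.conductorNorm ℤ = N)
    (hper : ∃ u : ℚ, ‖(u : ℚ_[p])‖ = 1 ∧ W.realPeriodRat = u * plusPeriod D.f)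
    {q' : ℚ} (hq' : shaAn W = (q' : ℂ)) (hv : padicValRat p q' = 0)
    (hc2 : padicValNat p W.tamagawaProduct ≤ 2)
    -- the geometric twist datum
    {d : ℤ} (hd4 : d % 4 = 1) (hsq : Squarefree d) (hd : 0 < d) (C : VariableChange ℚ)
    (hC : C • W₀.quadraticTwist (d : ℚ) = W)
    (hgm : ∀ v : HeightOneSpectrum (𝓞 ℚ), ((Rat.HeightOneSpectrum.primesEquiv v : ℕ) : ℤ) ∣ d →
      W₀.HasGoodReductionAt v ∨ W₀.HasMultiplicativeReductionAt v)
    -- the twist partner's newform at level `M ℓ`, `ℓ` the Tamagawa prime, `ℓ ∤ M`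
    {M : ℕ} [NeZero M] {ℓ : ℕ} [Fact ℓ.Prime] [NeZero (M * ℓ)] (hℓM : ¬ ℓ ∣ M) [NeZero d.natAbs]
    {f₀ : CuspForm (Gamma0 (M * ℓ)) 2} (hf₀ : IsNewformOf W₀ f₀)
    (hN₀ : M * ℓ ∣ N) (hm : d.natAbs ^ 2 ∣ N) (hmN : d.natAbs ∣ W.conductorNorm ℤ)
    (hper₀ : ∃ u : ℚ, ‖(u : ℚ_[p])‖ = 1 ∧ W₀.realPeriodRat = u * plusPeriod f₀)
    (hirr₀ : W₀.HasIrreducibleModPGaloisRep p)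
    (hℓN : ℓ ∣ W.conductorNorm ℤ) (hℓ : ℓ.Coprime d.natAbs)
    -- (MO) from print: eigencharacter, DDT Thm. 4.26 hypotheses + Galois package, repaired node, RIDER
    (χ₀ : HeckeRing0 (M * ℓ) 2 →+* k)
    (hχ₀ : ∀ (q : ℕ) (hq : q.Prime),
      χ₀ (HeckeRing0.T (M * ℓ) 2 q hq) = ι ((W₀.LFunction q : ℤ) : ZMod p))
    (hp𝔪 : (p : HeckeRing0 (M * ℓ) 2) ∈ RingHom.ker χ₀) (h𝔪 : (RingHom.ker χ₀).IsMaximal)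
    (hpN₀ : ¬ p ∣ M * ℓ ∨ (¬ p ^ 2 ∣ M * ℓ ∧ HeckeRing0.T (M * ℓ) 2 p hp5.out ∉ RingHom.ker χ₀))
    (k' : Type) [Field k'] [TopologicalSpace k'] [DiscreteTopology k']
    (ι' : HeckeRing0 (M * ℓ) 2 ⧸ RingHom.ker χ₀ →+* k') (ρ : ModPGaloisRep ℚ k' 2)
    (hρ : ∀ v : HeightOneSpectrum (𝓞 ℚ), ¬ ((primesEquiv v : Nat.Primes) : ℕ) ∣ M * ℓ * p →
        ρ.IsUnramifiedAt v ∧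
          ρ.HasFrobCharpolyAt v
            (X ^ 2
              - Polynomial.C (ι' (Ideal.Quotient.mk (RingHom.ker χ₀) (HeckeRing0.T (M * ℓ) 2
                  ((primesEquiv v : Nat.Primes) : ℕ) (primesEquiv v : Nat.Primes).2))) * X
              + Polynomial.C (((primesEquiv v : Nat.Primes) : ℕ) : k')))
    (hρirr : FramedRep.IsIrreducible ρ)
    (hES : EichlerShimuraModPMultiplicityOneOfIrreducible (M * ℓ) p χ₀
      (fun q ↦ ι ((W₀.LFunction q : ℤ) : ZMod p)))
    (hrid : p ≠ 3 ∨ 9 ∣ M * ℓ ∨ ∃ q : ℕ, q.Prime ∧ q ∣ M * ℓ ∧ q % 3 = 2)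
    -- (OLD) from print: the LEVEL-`M` EIGEN DATUM of Ribet's form (ONE predicate) + numerals
    {μ : ℚ → k}
    (hdat : HasLevelLoweredEigenDatum k M ℓ (fun q ↦ ι ((W₀.LFunction q : ℤ) : ZMod p)) μ)
    (heven : ∀ r : ℚ, μ (-r) = μ r) {w : k}
    (hwα : w * ι ((W₀.LFunction ℓ : ℤ) : ZMod p) = 1)
    (hw : w * ι ((J((ℓ : ℤ) | d.natAbs) : ℤ) : ZMod p) = 1) : BSDp W p := by
  obtain ⟨hμ, hΓ, ⟨θ, hT, hU, hθ, hα⟩, ⟨Λ, χ, hΛ, h𝔫, hE, ⟨x, hx, hΛx⟩, hμΛ⟩⟩ := hdat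
  exact bsdp_of_wiles1995_ihara_quadraticTwist_of_pos_of_kim2025_OPEN W₀ W p ι hW1 hI hK25s hCT hGZK
    hmod hp3 hr htower D hN hper hq' hv hc2 hd4 hsq hd C hC hgm hℓM hf₀ hN₀ hm hmN hper₀ hirr₀ hℓN
    hℓ χ₀ hχ₀ hp𝔪 h𝔪 hpN₀ k' ι' ρ hρ hρirr hES hrid hμ heven hΓ θ hT hU hθ hα hwα Λ χ hΛ h𝔫 hE hx
    hΛx hμΛ hw

/-- **TAM-DEFECT₂, twist-good locus, odd twists `d < 0`, `p ≥ 3` TOWER rows modulo the ANNOUNCED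
Kim 2025 clause (OPEN binder) — over the ONE typed datum** (odd `μ`); rider displayed. Nothing booked.
[claim: Kim2025RefinedTNC, status: under-review]
[cite: Kim2025RefinedTNC, Thm. 1.1 ("BSD") (ANNOUNCED, OPEN binder)]
[cite: DarmonDiamondTaylor1995, Thm. 4.26 (§4.5, p. 134) and Lemma 4.28 (a) (p. 135)]
[cite: Ribet1984ICM, Thm. 4.1] [cite: Ribet1990, Thm. 1.1 and Thm. 5.2 (b)] [cite: SilvermanAEC2009, Thm. X.4.14] -/
theorem bsdp_of_levelLoweredEigenDatum_quadraticTwist_of_neg_of_kim2025_OPEN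
    (hW1 : wiles1995_multiplicityOne) (hI : ribet1984_iharaLemma)
    (hK25s : Kim2025.thm11_kimShaLength_of_integralPeriod_OPEN)
    (hCT : exists_casselsTate_pairing (K := ℚ))
    (hGZK : rank_eq_analyticRank_of_analyticRank_le_one) (hmod : hasEntireLFunction_rat)
    (hp3 : 3 ≤ p) (hr : W.analyticRank = 0)
    (htower : ∀ n : ℕ, W.HasSurjectiveModNGaloisRep (p ^ n : ℕ))
    {N : ℕ} [NeZero N] (D : ModularParametrizationData W N) (hN : W.conductorNorm ℤ = N)
    (hper : ∃ u : ℚ, ‖(u : ℚ_[p])‖ = 1 ∧ W.realPeriodRat = u * plusPeriod D.f)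
    {q' : ℚ} (hq' : shaAn W = (q' : ℂ)) (hv : padicValRat p q' = 0)
    (hc2 : padicValNat p W.tamagawaProduct ≤ 2)
    {d : ℤ} (hd4 : d % 4 = 1) (hsq : Squarefree d) (hd : d < 0) (C : VariableChange ℚ)
    (hC : C • W₀.quadraticTwist (d : ℚ) = W)
    (hgm : ∀ v : HeightOneSpectrum (𝓞 ℚ), ((Rat.HeightOneSpectrum.primesEquiv v : ℕ) : ℤ) ∣ d →
      W₀.HasGoodReductionAt v ∨ W₀.HasMultiplicativeReductionAt v)
    {M : ℕ} [NeZero M] {ℓ : ℕ} [Fact ℓ.Prime] [NeZero (M * ℓ)] (hℓM : ¬ ℓ ∣ M) [NeZero d.natAbs]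
    {f₀ : CuspForm (Gamma0 (M * ℓ)) 2} (hf₀ : IsNewformOf W₀ f₀)
    (hN₀ : M * ℓ ∣ N) (hm : d.natAbs ^ 2 ∣ N) (hmN : d.natAbs ∣ W.conductorNorm ℤ)
    (hper₀ : ∃ u : ℚ, ‖(u : ℚ_[p])‖ = 1 ∧ W₀.imaginaryPeriodRat = u * minusPeriod f₀)
    (hint : ∀ x : ℚ, ¬ p ∣ (ratMinusSymbol f₀ x).den)
    (hℓN : ℓ ∣ W.conductorNorm ℤ) (hℓ : ℓ.Coprime d.natAbs)
    -- (MO⁻) from print, rider displayed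
    (χ₀ : HeckeRing0 (M * ℓ) 2 →+* k)
    (hχ₀ : ∀ (q : ℕ) (hq : q.Prime),
      χ₀ (HeckeRing0.T (M * ℓ) 2 q hq) = ι ((W₀.LFunction q : ℤ) : ZMod p))
    (hp𝔪 : (p : HeckeRing0 (M * ℓ) 2) ∈ RingHom.ker χ₀) (h𝔪 : (RingHom.ker χ₀).IsMaximal)
    (hpN₀ : ¬ p ∣ M * ℓ ∨ (¬ p ^ 2 ∣ M * ℓ ∧ HeckeRing0.T (M * ℓ) 2 p hp5.out ∉ RingHom.ker χ₀))
    (k' : Type) [Field k'] [TopologicalSpace k'] [DiscreteTopology k']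
    (ι' : HeckeRing0 (M * ℓ) 2 ⧸ RingHom.ker χ₀ →+* k') (ρ : ModPGaloisRep ℚ k' 2)
    (hρ : ∀ v : HeightOneSpectrum (𝓞 ℚ), ¬ ((primesEquiv v : Nat.Primes) : ℕ) ∣ M * ℓ * p →
        ρ.IsUnramifiedAt v ∧
          ρ.HasFrobCharpolyAt v
            (X ^ 2
              - Polynomial.C (ι' (Ideal.Quotient.mk (RingHom.ker χ₀) (HeckeRing0.T (M * ℓ) 2
                  ((primesEquiv v : Nat.Primes) : ℕ) (primesEquiv v : Nat.Primes).2))) * X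
              + Polynomial.C (((primesEquiv v : Nat.Primes) : ℕ) : k')))
    (hρirr : FramedRep.IsIrreducible ρ)
    (hES : EichlerShimuraModPMultiplicityOneMinusOfIrreducible (M * ℓ) p χ₀
      (fun q ↦ ι ((W₀.LFunction q : ℤ) : ZMod p)))
    (hrid : p ≠ 3 ∨ 9 ∣ M * ℓ ∨ ∃ q : ℕ, q.Prime ∧ q ∣ M * ℓ ∧ q % 3 = 2)
    -- (OLD) from print: the LEVEL-`M` EIGEN DATUM of Ribet's form (ONE predicate) + numerals
    {μ : ℚ → k}
    (hdat : HasLevelLoweredEigenDatum k M ℓ (fun q ↦ ι ((W₀.LFunction q : ℤ) : ZMod p)) μ)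
    (hodd : ∀ r : ℚ, μ (-r) = -μ r) {w : k}
    (hwα : w * ι ((W₀.LFunction ℓ : ℤ) : ZMod p) = 1)
    (hw : w * ι ((J((ℓ : ℤ) | d.natAbs) : ℤ) : ZMod p) = 1) : BSDp W p := by
  obtain ⟨hμ, hΓ, ⟨θ, hT, hU, hθ, hα⟩, ⟨Λ, χ, hΛ, h𝔫, hE, ⟨x, hx, hΛx⟩, hμΛ⟩⟩ := hdat
  exact bsdp_of_wiles1995_ihara_quadraticTwist_of_neg_of_kim2025_OPEN W₀ W p ι hW1 hI hK25s hCT hGZK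
    hmod hp3 hr htower D hN hper hq' hv hc2 hd4 hsq hd C hC hgm hℓM hf₀ hN₀ hm hmN hper₀ hint hℓN hℓ
    χ₀ hχ₀ hp𝔪 h𝔪 hpN₀ k' ι' ρ hρ hρirr hES hrid hμ hodd hΓ θ hT hU hθ hα hwα Λ χ hΛ h𝔫 hE hx hΛx
    hμΛ hw

end Summit.BirchSwinnertonDyer.Rank1Residual.X4

end
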